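import Literature.Analysis.FluidPDE.NSSliceTimeIncrement
import HarnessLib

/-!
# Translated bump test fields and the mollification estimate against Hölder slices

Support file for the discharge of `Literature.Analysis.FluidPDE.NSSliceTimeContinuity`
(`FluidPDE/NSBoundedInteriorRegularity`). The spatial test fields used there are
`η(x) = ρ(x - q) v` with `ρ = φ.normed` the normalised bump of a `ContDiffBump (0 : ℝ³)`,
`q` a centre and `v` a fixed vector:

* `isTestFunctionOn_bump_smul` — `η` is a test field on any open set containing
  `B̄(q, r_out)`;
* `fderiv_bump_smul`, `laplacian_bump_smul`, `exists_bump_smul_bounds` — derivatives of the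
  translates are translates of the derivatives, so `‖Dη‖`, `‖Δη‖` are bounded uniformly in `q`;
* `abs_inner_sub_setIntegral_bump_smul_le` — **mollification against a Hölder slice**: if `w` is
  `(C, α)`-Hölder on an open `S ⊇ B̄(q, r_out)`, `α > 0`, then
  `|⟪w(q), v⟫ - ∫_S ⟪w, η⟫| ≤ C r_out^α ‖v‖` (`∫ ρ = 1`, `ρ ≥ 0`);
* `norm_le_sum_abs_inner_basisFun` — `‖y‖ ≤ ∑ᵢ |⟪y, eᵢ⟫|` in `ℝ³`.

Folklore.
-/

noncomputable section

open MeasureTheory Set Function Filter Topology TopologicalSpace Metric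
open scoped NNReal ENNReal InnerProductSpace RealInnerProductSpace Laplacian

namespace Literature.Analysis.FluidPDE

/-- Local notation for physical space `ℝ³ = EuclideanSpace ℝ (Fin 3)`. -/
local notation "ℝ³" => EuclideanSpace ℝ (Fin 3)

/-! ### Translated bump test fields -/

section Bump

variable (φ : ContDiffBump (0 : ℝ³)) (q v : ℝ³)

/-- `x ↦ ρ(x - q) v` is smooth. [folklore] -/
theorem contDiff_bump_smul : ContDiff ℝ (⊤ : ℕ∞) fun x : ℝ³ => φ.normed volume (x - q) • v :=
  (φ.contDiff_normed.comp (contDiff_id.sub contDiff_const)).smul contDiff_const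

/-- `ρ(x - q) v = 0` once `dist x q ≥ r_out`. [folklore] -/
theorem bump_smul_eq_zero {x : ℝ³} (hx : φ.rOut ≤ dist x q) : φ.normed volume (x - q) • v = 0 := by
  rw [φ.normed_def, φ.zero_of_le_dist (by simpa [dist_eq_norm] using hx), zero_div, zero_smul]

/-- The translated bump field is a test field on every open set containing `B̄(q, r_out)`.
[folklore] -/
theorem isTestFunctionOn_bump_smul {Ω : Set ℝ³} (hΩ : IsOpen Ω) (hq : closedBall q φ.rOut ⊆ Ω) :
    FunctionSpaces.IsTestFunctionOn ⟨Ω, hΩ⟩ (fun x : ℝ³ => φ.normed volume (x - q) • v) := by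
  have hsupp : support (fun x : ℝ³ => φ.normed volume (x - q) • v) ⊆ closedBall q φ.rOut := by
    intro x hx
    by_contra h
    exact hx (bump_smul_eq_zero φ q v (le_of_lt (by simpa [mem_closedBall] using h)))
  have htsupp : tsupport (fun x : ℝ³ => φ.normed volume (x - q) • v) ⊆ closedBall q φ.rOut :=
    closure_minimal hsupp isClosed_closedBall
  exact ⟨contDiff_bump_smul φ q v,
    HasCompactSupport.of_support_subset_isCompact (isCompact_closedBall q φ.rOut) hsupp,
    htsupp.trans hq⟩

/-- Derivative of a translate: `D(η(· - q))(x) = (Dη₀)(x - q)`, `η₀ = ρ v`. [folklore] -/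
theorem fderiv_bump_smul (x : ℝ³) :
    fderiv ℝ (fun y : ℝ³ => φ.normed volume (y - q) • v) x =
      fderiv ℝ (fun y : ℝ³ => φ.normed volume y • v) (x - q) :=
  fderiv_comp_sub (f := fun y : ℝ³ => φ.normed volume y • v) q

/-- Laplacian of a translate: `Δ(η(· - q))(x) = (Δη₀)(x - q)`, `η₀ = ρ v`. [folklore] -/
theorem laplacian_bump_smul (x : ℝ³) :
    Δ (fun y : ℝ³ => φ.normed volume (y - q) • v) x = Δ (fun y : ℝ³ => φ.normed volume y • v) (x - q) := by
  rw [InnerProductSpace.laplacian_eq_iteratedFDeriv_stdOrthonormalBasis,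
    InnerProductSpace.laplacian_eq_iteratedFDeriv_stdOrthonormalBasis]
  simp only [iteratedFDeriv_comp_sub' (f := fun y : ℝ³ => φ.normed volume y • v)]

/-- **Uniform derivative bounds for the translates.** There are `K₁, K₂` with
`‖D(ρ(· - q) v)‖ ≤ K₁` and `‖Δ(ρ(· - q) v)‖ ≤ K₂` for all centres `q`. [folklore] -/
theorem exists_bump_smul_bounds :
    ∃ K₁ K₂ : ℝ, ∀ q x : ℝ³, ‖fderiv ℝ (fun y : ℝ³ => φ.normed volume (y - q) • v) x‖ ≤ K₁ ∧
      ‖Δ (fun y : ℝ³ => φ.normed volume (y - q) • v) x‖ ≤ K₂ := by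
  have h0 : FunctionSpaces.IsTestFunctionOn (⊤ : Opens ℝ³) (fun y : ℝ³ => φ.normed volume (y - 0) • v) :=
    isTestFunctionOn_bump_smul φ 0 v isOpen_univ (subset_univ _)
  simp only [sub_zero] at h0
  obtain ⟨-, K₁, K₂, -, hK₁, hK₂⟩ := exists_bounds_of_isTestFunctionOn h0
  refine ⟨K₁, K₂, fun q x => ⟨?_, ?_⟩⟩
  · rw [fderiv_bump_smul]; exact hK₁ _
  · rw [laplacian_bump_smul]; exact hK₂ _

/-- `∫ ρ(x - q) dx = 1`. [folklore] -/
theorem integral_bump_sub (q : ℝ³) : ∫ x : ℝ³, φ.normed volume (x - q) = 1 := by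
  rw [integral_sub_right_eq_self (fun x : ℝ³ => φ.normed volume x) q, φ.integral_normed]

end Bump

/-! ### Mollification against a Hölder slice -/

/-- **Mollification against a Hölder slice.** Let `w` be `(C, α)`-Hölder on an open set `S` with
`α > 0`, let `B̄(q, r_out) ⊆ S` and `η(x) = ρ(x - q) v`. Then
`|⟪w(q), v⟫ - ∫_S ⟪w(x), η(x)⟫ dx| ≤ C r_out^α ‖v‖`: write the difference as
`∫ ρ(x - q) ⟪w(q) - w(x), v⟫ dx` using `∫ ρ = 1`, and bound the integrand by
`ρ(x - q) C r_out^α ‖v‖` on the support `B(q, r_out)`. [folklore] -/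
theorem abs_inner_sub_setIntegral_bump_smul_le {w : ℝ³ → ℝ³} {S : Set ℝ³} (hS : IsOpen S)
    {C α : ℝ≥0} (hα : 0 < α) (hw : HolderOnWith C α w S) (φ : ContDiffBump (0 : ℝ³)) {q : ℝ³}
    (hq : closedBall q φ.rOut ⊆ S) (v : ℝ³) :
    |⟪w q, v⟫ - ∫ x in S, ⟪w x, φ.normed volume (x - q) • v⟫| ≤ C * φ.rOut ^ (α : ℝ) * ‖v‖ := by
  set ρ : ℝ³ → ℝ := fun x => φ.normed volume (x - q) with hρ
  set L : ℝ := C * φ.rOut ^ (α : ℝ) * ‖v‖ with hL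
  have hL0 : 0 ≤ L := by
    have : 0 ≤ φ.rOut ^ (α : ℝ) := Real.rpow_nonneg φ.rOut_pos.le _
    positivity
  have hρc : Continuous ρ := φ.continuous_normed.comp (continuous_id.sub continuous_const)
  have hρ0 : ∀ x, 0 ≤ ρ x := fun x => φ.nonneg_normed _
  have hρz : ∀ x, x ∉ ball q φ.rOut → ρ x = 0 := fun x hx => by
    simp only [hρ, φ.normed_def]
    rw [φ.zero_of_le_dist (by simpa [mem_ball, dist_eq_norm] using hx), zero_div]
  have hρ1 : ∫ x, ρ x = 1 := integral_bump_sub φ q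
  have hρi : Integrable ρ := by
    refine Integrable.of_integral_ne_zero fun h => ?_
    rw [h] at hρ1; exact zero_ne_one hρ1
  have hqS : q ∈ S := hq (mem_closedBall_self φ.rOut_pos.le)
  have hbS : ball q φ.rOut ⊆ S := ball_subset_closedBall.trans hq
  -- the integrand and its pointwise bound
  set F : ℝ³ → ℝ := fun x => ρ x * ⟪w x - w q, v⟫ with hF
  have hFb : ∀ x, ‖F x‖ ≤ ρ x * L := fun x => by
    by_cases hx : x ∈ ball q φ.rOut
    · rw [hF]
      dsimp only
      rw [norm_mul, Real.norm_of_nonneg (hρ0 x)]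
      refine mul_le_mul_of_nonneg_left ?_ (hρ0 x)
      calc ‖⟪w x - w q, v⟫‖ ≤ ‖w x - w q‖ * ‖v‖ := norm_inner_le_norm _ _
        _ ≤ C * φ.rOut ^ (α : ℝ) * ‖v‖ := by
            gcongr
            rw [← dist_eq_norm]
            exact hw.dist_le_of_le (hbS hx) hqS (le_of_lt (mem_ball.1 hx))
    · simp [hF, hρz x hx]
  -- continuity of `F`: it vanishes off the ball, inside `S` it is continuous
  have hwc : ContinuousOn w S := hw.continuousOn hα
  have hFc : Continuous F := by
    rw [continuous_iff_continuousAt]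
    intro x
    by_cases hx : x ∈ S
    · have hcs : ContinuousOn F S :=
        (hρc.continuousOn).mul ((hwc.sub continuousOn_const).inner continuousOn_const)
      exact hcs.continuousAt (hS.mem_nhds hx)
    · -- near `x ∉ S ⊇ B̄(q, r_out)`, `F` vanishes identically
      have hx' : x ∉ closedBall q φ.rOut := fun h => hx (hq h)
      have hnhds : (closedBall q φ.rOut)ᶜ ∈ 𝓝 x := isClosed_closedBall.isOpen_compl.mem_nhds hx'
      refine (continuousAt_const (y := (0 : ℝ))).congr (eventuallyEq_of_mem hnhds fun y hy => ?_)
      have hy' : y ∉ ball q φ.rOut := fun h => hy (ball_subset_closedBall h)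
      simp [hF, hρz y hy']
  have hFi : Integrable F := by
    refine Integrable.mono' (hρi.mul_const L) hFc.aestronglyMeasurable (Eventually.of_forall hFb)
  -- rewrite the difference as `-∫ F`
  have hpair : ∫ x in S, ⟪w x, φ.normed volume (x - q) • v⟫ = ∫ x, ρ x * ⟪w x, v⟫ := by
    rw [setIntegral_eq_integral_of_forall_compl_eq_zero fun x hx => ?_]
    · exact integral_congr_ae (Eventually.of_forall fun x => by
        simp only [hρ, real_inner_smul_right])
    · have hx' : x ∉ ball q φ.rOut := fun h => hx (hbS h)
      have : φ.normed volume (x - q) = 0 := hρz x hx'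
      simp [this]
  have hconst : ⟪w q, v⟫ = ∫ x, ρ x * ⟪w q, v⟫ := by
    rw [MeasureTheory.integral_mul_const, hρ1, one_mul]
  have hdiff : ⟪w q, v⟫ - ∫ x in S, ⟪w x, φ.normed volume (x - q) • v⟫ = -∫ x, F x := by
    have h1 : Integrable fun x => ρ x * ⟪w x, v⟫ := by
      have : (fun x => ρ x * ⟪w x, v⟫) = fun x => F x + ρ x * ⟪w q, v⟫ := by
        ext x; simp only [hF, inner_sub_left]; ring
      rw [this]
      exact hFi.add (hρi.mul_const _)
    rw [hpair, hconst, ← integral_sub (hρi.mul_const _) h1, ← MeasureTheory.integral_neg]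
    refine integral_congr_ae (Eventually.of_forall fun x => ?_)
    simp only [hF, inner_sub_left]
    ring
  rw [hdiff, abs_neg, ← Real.norm_eq_abs]
  calc ‖∫ x, F x‖ ≤ ∫ x, ρ x * L := norm_integral_le_of_norm_le (hρi.mul_const L)
        (Eventually.of_forall hFb)
    _ = L := by rw [MeasureTheory.integral_mul_const, hρ1, one_mul]

/-! ### Norms through the standard basis -/

/-- `‖y‖ ≤ ∑ᵢ |⟪y, eᵢ⟫|` for the standard orthonormal basis of `ℝ³`. [folklore] -/
theorem norm_le_sum_abs_inner_basisFun (y : ℝ³) :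
    ‖y‖ ≤ ∑ i, |⟪y, EuclideanSpace.basisFun (Fin 3) ℝ i⟫| := by
  set b := EuclideanSpace.basisFun (Fin 3) ℝ
  conv_lhs => rw [← b.sum_repr' y]
  refine (norm_sum_le _ _).trans (Finset.sum_le_sum fun i _ => ?_)
  rw [norm_smul, b.norm_eq_one i, mul_one, Real.norm_eq_abs, real_inner_comm]


/-! ### Comparing two Hölder slices through their bump pairings -/

/-- **Two Hölder slices whose bump pairings are close are uniformly close on the smaller ball.**
Let `w₁, w₂` be `(C, α)`-Hölder on `B(x₀, R)`, `α > 0`, let `ρ` be the normalised bump of radius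
`r_out < R - r` and `q : ℕ → ℝ³` a dense sequence. If for every centre `qₖ ∈ B(x₀, r)` and every
basis vector `eᵢ` the pairings `∫_B ⟪w_j, ρ(· - qₖ) eᵢ⟫` of `w₁` and `w₂` differ by at most
`Aᵢ D`, then `‖w₁(y) - w₂(y)‖ ≤ 6 C r_out^α + (∑ᵢ Aᵢ) D` for all `y ∈ B(x₀, r)`: compare both slices
with their mollifications at a centre `qₖ` near `y` (`abs_inner_sub_setIntegral_bump_smul_le`),
use the Hölder modulus between `y` and `qₖ`, sum over the basis, and let `qₖ → y`. [folklore] -/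
theorem norm_sub_le_of_bump_pairings {w₁ w₂ : ℝ³ → ℝ³} {x₀ : ℝ³} {r R : ℝ} {C α : ℝ≥0}
    (hα : 0 < α) (h₁ : HolderOnWith C α w₁ (ball x₀ R)) (h₂ : HolderOnWith C α w₂ (ball x₀ R))
    (φ : ContDiffBump (0 : ℝ³)) (hφ : φ.rOut < R - r) {q : ℕ → ℝ³} (hq : DenseRange q)
    {A : Fin 3 → ℝ} {D : ℝ}
    (hpair : ∀ k i, q k ∈ ball x₀ r →
      |(∫ x in ball x₀ R, ⟪w₁ x, φ.normed volume (x - q k) • EuclideanSpace.basisFun (Fin 3) ℝ i⟫) -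
        ∫ x in ball x₀ R, ⟪w₂ x, φ.normed volume (x - q k) • EuclideanSpace.basisFun (Fin 3) ℝ i⟫| ≤
        A i * D)
    {y : ℝ³} (hy : y ∈ ball x₀ r) :
    ‖w₁ y - w₂ y‖ ≤ 6 * C * φ.rOut ^ (α : ℝ) + (∑ i, A i) * D := by
  set e := EuclideanSpace.basisFun (Fin 3) ℝ with he
  set δ : ℝ := φ.rOut with hδ
  have hrR : ball x₀ r ⊆ ball x₀ R := ball_subset_ball (by linarith [φ.rOut_pos])
  have hyR : y ∈ ball x₀ R := hrR hy
  -- the bound at a centre `q k ∈ B(x₀, r)`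
  have hcentre : ∀ k, q k ∈ ball x₀ r →
      ‖w₁ y - w₂ y‖ ≤ 6 * C * dist y (q k) ^ (α : ℝ) + 6 * C * δ ^ (α : ℝ) + (∑ i, A i) * D := by
    intro k hk
    have hkR : q k ∈ ball x₀ R := hrR hk
    have hcb : closedBall (q k) φ.rOut ⊆ ball x₀ R := by
      intro x hx
      rw [mem_closedBall] at hx
      rw [mem_ball] at hk ⊢
      linarith [dist_triangle x (q k) x₀]
    have hcomp : ∀ i, |⟪w₁ y - w₂ y, e i⟫| ≤
        2 * C * dist y (q k) ^ (α : ℝ) + 2 * C * δ ^ (α : ℝ) + A i * D := by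
      intro i
      have m₁ := abs_inner_sub_setIntegral_bump_smul_le isOpen_ball hα h₁ φ hcb (e i)
      have m₂ := abs_inner_sub_setIntegral_bump_smul_le isOpen_ball hα h₂ φ hcb (e i)
      have hp := hpair k i hk
      rw [show ‖e i‖ = 1 from e.norm_eq_one i, mul_one] at m₁ m₂
      have d₁ : |⟪w₁ y - w₁ (q k), e i⟫| ≤ C * dist y (q k) ^ (α : ℝ) := by
        refine (abs_real_inner_le_norm _ _).trans ?_
        rw [e.norm_eq_one i, mul_one, ← dist_eq_norm]
        exact h₁.dist_le hyR hkR
      have d₂ : |⟪w₂ y - w₂ (q k), e i⟫| ≤ C * dist y (q k) ^ (α : ℝ) := by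
        refine (abs_real_inner_le_norm _ _).trans ?_
        rw [e.norm_eq_one i, mul_one, ← dist_eq_norm]
        exact h₂.dist_le hyR hkR
      -- telescoping
      have key : ⟪w₁ y - w₂ y, e i⟫ = ⟪w₁ y - w₁ (q k), e i⟫ - ⟪w₂ y - w₂ (q k), e i⟫ +
          ((⟪w₁ (q k), e i⟫ - ∫ x in ball x₀ R, ⟪w₁ x, φ.normed volume (x - q k) • e i⟫) -
           (⟪w₂ (q k), e i⟫ - ∫ x in ball x₀ R, ⟪w₂ x, φ.normed volume (x - q k) • e i⟫) +
           ((∫ x in ball x₀ R, ⟪w₁ x, φ.normed volume (x - q k) • e i⟫) -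
             ∫ x in ball x₀ R, ⟪w₂ x, φ.normed volume (x - q k) • e i⟫)) := by
        simp only [inner_sub_left]
        ring
      rw [key]
      refine (abs_add_le _ _).trans ?_
      refine (add_le_add ((abs_sub _ _).trans (add_le_add d₁ d₂))
        ((abs_add_le _ _).trans (add_le_add ((abs_sub _ _).trans (add_le_add m₁ m₂)) hp))).trans ?_
      ring_nf
      rfl
    calc ‖w₁ y - w₂ y‖ ≤ ∑ i, |⟪w₁ y - w₂ y, e i⟫| := norm_le_sum_abs_inner_basisFun _
      _ ≤ ∑ i, (2 * C * dist y (q k) ^ (α : ℝ) + 2 * C * δ ^ (α : ℝ) + A i * D) :=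
          Finset.sum_le_sum fun i _ => hcomp i
      _ = 6 * C * dist y (q k) ^ (α : ℝ) + 6 * C * δ ^ (α : ℝ) + (∑ i, A i) * D := by
          simp only [Finset.sum_add_distrib, Finset.sum_const, Finset.card_univ, Fintype.card_fin,
            nsmul_eq_mul, Finset.sum_mul]
          push_cast
          ring
  -- let `q k → y`
  by_contra hlt
  replace hlt := not_le.1 hlt
  set G : ℝ³ → ℝ := fun x => 6 * C * dist y x ^ (α : ℝ) with hG
  have hGc : Continuous G :=
    continuous_const.mul ((continuous_const.dist continuous_id).rpow_const fun _ => Or.inr α.2)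
  have hGy : G y = 0 := by simp [hG, Real.zero_rpow (NNReal.coe_pos.2 hα).ne']
  have hev : ∀ᶠ x in 𝓝 y, G x < ‖w₁ y - w₂ y‖ - (6 * C * δ ^ (α : ℝ) + (∑ i, A i) * D) := by
    refine hGc.continuousAt.eventually (gt_mem_nhds ?_)
    rw [hGy]; linarith
  obtain ⟨U, hU, hUo, hyU⟩ := _root_.mem_nhds_iff.1 hev
  obtain ⟨k, hk⟩ := hq.exists_mem_open (hUo.inter isOpen_ball) ⟨y, hyU, hy⟩
  have h1 : G (q k) < ‖w₁ y - w₂ y‖ - (6 * C * δ ^ (α : ℝ) + (∑ i, A i) * D) := hU hk.1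
  have h2 := hcentre k hk.2
  simp only [hG] at h1
  linarith

end Literature.Analysis.FluidPDE
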